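import Summits.AtomisticToContinuum.Crystallization.Theorems.PricedLinkCensusTruncatedCensusGapGapOfPeriodicPricing
import Summits.AtomisticToContinuum.Crystallization.Theorems.PricedLinkCensusTruncatedCensusGapBlocksTruncLJ
import Summits.AtomisticToContinuum.Crystallization.Theorems.PricedLinkCensusTruncatedCensusGapPeriodicPricingOfGap

/-!
# `TruncatedCensusGap` (stmt-AtomisticToContinuum-14230): the PERIODIC FORM of the crux

Lead c3 of line `sharp-m-potential-compactness` (crux directory `Cruxes/TruncatedCensusGap/`),
compositions of the landed wave-2 sub-goals (p127773, p127907, p127840):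

* `periodicPricing_of_truncatedCensusGap` — the crux implies that every periodic configuration `Q`
  of `ℝ³` pays `κ` per charged motif site above the periodic infimum,
  `κ · motifCharged (1/100) Q ≤ #F · (e_χ(Q) − e_χ*)` (blocks are trial states for the range-2
  potential, deep block points carry the charge of their motif point);
* `truncatedCensusGap_iff_periodicPricing` — **the crux is EXACTLY this periodic pricing** (twin,
  for `V_χ`, of `ChargedEnergyGapNegative.chargedEnergyGap_iff_periodicPricing`); finite clusters,
  free boundaries and `N` play no role: the crux is a statement of Blanc–Lewin's periodic universe,
  "the excess energy density of a periodic configuration over the periodic infimum controls its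
  density of sites that are not charge-free at tolerance `1/100`" — finite-range periodic
  crystallization with defect pricing for `V_χ` (open; see the line card);
* `lt_energyPerParticle_of_motifCharged` — the route's KILL CRITERION as a theorem: under the crux a
  periodic configuration with a single charged motif site is NOT a periodic minimiser
  (`e_χ* < e_χ(Q)`); a charged periodic `V_χ`-minimiser refutes the crux.

All `[folklore]` bookkeeping; the content of the crux is untouched.
-/

noncomputable section

namespace Summit.AtomisticToContinuum.Crystallization.Theorems.PricedLinkCensusTruncatedCensusGap

open Literature.MathematicalPhysics.StatisticalMechanics Literature.Geometry.DiscreteGeometry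
open Summit.AtomisticToContinuum.Crystallization.Theorems.ChargedEnergyGapNegative (motifCharged)

/-- **The crux implies the periodic pricing** (for `V_χ`): composition of the landed reduction
modulo blocks (p127840) with the landed block trial-state lemma (p127907). [folklore] -/
theorem periodicPricing_of_truncatedCensusGap : Summit.AtomisticToContinuum.Crystallization.Theses.PricedLinkCensus.TruncatedCensusGap → (∃ κ : ℝ, 0 < κ ∧ ∀ Q : PeriodicConfiguration 3, κ * (Summit.AtomisticToContinuum.Crystallization.Theorems.ChargedEnergyGapNegative.motifCharged (1 / 100) Q : ℝ) ≤ (Q.motif.card : ℝ) * (Q.energyPerParticle (fun r => min 1 (max 0 (4 - 2 * r)) * lennardJones r) - ⨅ Q' : PeriodicConfiguration 3, Q'.energyPerParticle (fun r => min 1 (max 0 (4 - 2 * r)) * lennardJones r))) :=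
  periodicPricing_of_truncatedCensusGap_of_blocks exists_block_energy_le_truncLJ

/-- **`TruncatedCensusGap` is EQUIVALENT to the periodic pricing for `V_χ`.** [folklore] -/
theorem truncatedCensusGap_iff_periodicPricing : Summit.AtomisticToContinuum.Crystallization.Theses.PricedLinkCensus.TruncatedCensusGap ↔ (∃ κ : ℝ, 0 < κ ∧ ∀ Q : PeriodicConfiguration 3, κ * (Summit.AtomisticToContinuum.Crystallization.Theorems.ChargedEnergyGapNegative.motifCharged (1 / 100) Q : ℝ) ≤ (Q.motif.card : ℝ) * (Q.energyPerParticle (fun r => min 1 (max 0 (4 - 2 * r)) * lennardJones r) - ⨅ Q' : PeriodicConfiguration 3, Q'.energyPerParticle (fun r => min 1 (max 0 (4 - 2 * r)) * lennardJones r))) :=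
  ⟨periodicPricing_of_truncatedCensusGap, truncatedCensusGap_of_periodicPricing⟩

/-- **Kill criterion.** Under the crux, a periodic configuration with at least one charged motif
site (charge read in the infinite point set, tolerance `1/100`) lies STRICTLY above the periodic
infimum: `e_χ* < e_χ(Q)`.  Contrapositive: a charged periodic `V_χ`-minimiser refutes
`TruncatedCensusGap`. [folklore] -/
theorem lt_energyPerParticle_of_motifCharged
    (h : Summit.AtomisticToContinuum.Crystallization.Theses.PricedLinkCensus.TruncatedCensusGap)
    (Q : PeriodicConfiguration 3) (hQ : 0 < motifCharged (1 / 100) Q) :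
    (⨅ Q' : PeriodicConfiguration 3, Q'.energyPerParticle (fun r => min 1 (max 0 (4 - 2 * r)) * lennardJones r)) < Q.energyPerParticle (fun r => min 1 (max 0 (4 - 2 * r)) * lennardJones r) := by
  obtain ⟨κ, hκ, hp⟩ := periodicPricing_of_truncatedCensusGap h
  have h1 := hp Q
  have hF : (0 : ℝ) < Q.motif.card := by exact_mod_cast Q.motif_nonempty.card_pos
  have hm : (1 : ℝ) ≤ motifCharged (1 / 100) Q := by exact_mod_cast hQ
  have hpos : 0 < κ * (motifCharged (1 / 100) Q : ℝ) := mul_pos hκ (by linarith)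
  by_contra hle
  push Not at hle
  have : (Q.motif.card : ℝ) * (Q.energyPerParticle (fun r => min 1 (max 0 (4 - 2 * r)) * lennardJones r) -
      ⨅ Q' : PeriodicConfiguration 3, Q'.energyPerParticle (fun r => min 1 (max 0 (4 - 2 * r)) * lennardJones r)) ≤ 0 :=
    mul_nonpos_of_nonneg_of_nonpos hF.le (by linarith)
  linarith

end Summit.AtomisticToContinuum.Crystallization.Theorems.PricedLinkCensusTruncatedCensusGap

end
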